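import Literature.Analysis.ODE.ComplexSecondOrder
import HarnessLib

/-!
# `y'' = Q y` with a parameter in the coefficient: forced equations, continuous and holomorphic
# dependence of solutions on the parameter

Topic `Literature/Analysis/ODE` (namespace `Literature.Analysis.ODE`), continuing
`ComplexSecondOrder.lean` (`𝕜 = ℝ` or `ℂ`). Everything is proved:

* `IsForcedSol2 Q F y y' s` — classical solutions of the forced equation `y'' = Q y + F` on a
  set; difference quotients of solutions of two homogeneous equations are forced solutions
  (`IsSol2.isForcedSol2_smul_sub`); Grönwall continuous dependence for forced equations on a
  compact interval, in both time directions (`IsForcedSol2.dist_le`), and the a priori bound for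
  zero data (`IsForcedSol2.norm_le_of_zero_data`).
* For a **family** of coefficients in separated form `Q p t = Σ_i g i p · h i t` (finitely many
  terms; `h i` continuous on `[a, b] ⊂ (r₀, ∞)`) and solutions `y p` of `y'' = Q p · y` on
  `(r₀, ∞)` with data at `t₀ ∈ [a, b]` independent of `p`:
  - `tendstoUniformlyOn_param` — if the `g i` are continuous at `p₀` then
    `(y p, y' p) → (y p₀, y' p₀)` uniformly on `[a, b]` as `p → p₀`;
  - `differentiableAt_param` — if the parameter is a scalar `p ∈ 𝕜` and the `g i` are
    differentiable at `p₀`, then `p ↦ y p t`, `p ↦ y' p t` are differentiable at `p₀` for every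
    `t ∈ [a, b]` (for `𝕜 = ℂ`: **holomorphic dependence on the parameter**). The proof avoids the
    variational equation: the difference quotients form a Cauchy family by Grönwall
    (`exists_tendsto_of_cauchy`), and their limit is the derivative.

These serve the matching-function construction for the radial Klein–Gordon equation on Kerr
(Shlapentokh-Rothman, CMP 329 (2014), §4.3 and App. C: connection coefficients "holomorphic in
`ω`"), where the coefficient is polynomial in the frequency `ω` and in the separation constant.

## References
* P. Hartman, *Ordinary Differential Equations*, Classics in Applied Mathematics 38 (SIAM 2002),
  Ch. V Thm. 2.1 (continuous dependence), Thm. 3.1 (differentiability in parameters).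
  Key `Hartman2002`.
* Y. Shlapentokh-Rothman, Comm. Math. Phys. 329 (2014) 859–891, §4.3, App. C.
  Key `ShlapentokhRothman2014KleinGordon`.
-/

noncomputable section

open Set Metric Filter
open scoped Topology ComplexConjugate NNReal

/-! ## Forced equations `y'' = Q y + F` and continuous dependence -/

namespace Literature.Analysis.ODE

variable {𝕜 : Type*} [RCLike 𝕜]

/-- `IsForcedSol2 Q F y y' s`: on `s`, `y` has derivative `y'` and `y'` has derivative
`Q t · y t + F t` — a classical solution of the forced equation `y'' = Q y + F` (the shape of
variational equations and of difference quotients in a parameter). [folklore] -/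
structure IsForcedSol2 (Q F : ℝ → 𝕜) (y y' : ℝ → 𝕜) (s : Set ℝ) : Prop where
  hasDerivAt : ∀ t ∈ s, HasDerivAt y (y' t) t
  hasDerivAt_deriv : ∀ t ∈ s, HasDerivAt y' (Q t * y t + F t) t

namespace IsSol2

variable {Q : ℝ → 𝕜} {y y' : ℝ → 𝕜} {s : Set ℝ}

/-- A solution of the homogeneous equation is a forced solution with forcing `0`. [folklore] -/
theorem isForcedSol2 (h : IsSol2 Q y y' s) : IsForcedSol2 Q (fun _ ↦ 0) y y' s :=
  ⟨h.hasDerivAt, fun t ht ↦ by simpa using h.hasDerivAt_deriv t ht⟩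

/-- **Difference quotients.** If `y₁'' = Q₁ y₁` and `y₀'' = Q₀ y₀` on `s` then for every scalar
`c`, `c (y₁ − y₀)` solves the forced equation with coefficient `Q₁` and forcing
`c (Q₁ − Q₀) y₀`. [folklore] -/
theorem isForcedSol2_smul_sub {Q₁ Q₀ : ℝ → 𝕜} {y₁ y₁' y₀ y₀' : ℝ → 𝕜} (h₁ : IsSol2 Q₁ y₁ y₁' s)
    (h₀ : IsSol2 Q₀ y₀ y₀' s) (c : 𝕜) :
    IsForcedSol2 Q₁ (fun t ↦ c * ((Q₁ t - Q₀ t) * y₀ t)) (fun t ↦ c * (y₁ t - y₀ t))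
      (fun t ↦ c * (y₁' t - y₀' t)) s :=
  ⟨fun t ht ↦ ((h₁.hasDerivAt t ht).sub (h₀.hasDerivAt t ht)).const_mul c, fun t ht ↦
    (((h₁.hasDerivAt_deriv t ht).sub (h₀.hasDerivAt_deriv t ht)).const_mul c).congr_deriv (by ring)⟩

end IsSol2

namespace IsForcedSol2

variable {Q Q₁ Q₂ F F₁ F₂ : ℝ → 𝕜} {y y' z z' : ℝ → 𝕜} {s : Set ℝ}

/-- The zero function solves every forced equation with forcing `0`. [folklore] -/
theorem zero : IsForcedSol2 Q (fun _ ↦ 0) (fun _ ↦ (0 : 𝕜)) (fun _ ↦ 0) s :=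
  ⟨fun t _ ↦ hasDerivAt_const t 0, fun t _ ↦ by simpa using hasDerivAt_const t (0 : 𝕜)⟩

/-- Differences of forced solutions (same coefficient) are forced solutions. [folklore] -/
theorem sub (h₁ : IsForcedSol2 Q F₁ y y' s) (h₂ : IsForcedSol2 Q F₂ z z' s) :
    IsForcedSol2 Q (fun t ↦ F₁ t - F₂ t) (fun t ↦ y t - z t) (fun t ↦ y' t - z' t) s :=
  ⟨fun t ht ↦ (h₁.hasDerivAt t ht).sub (h₂.hasDerivAt t ht), fun t ht ↦
    ((h₁.hasDerivAt_deriv t ht).sub (h₂.hasDerivAt_deriv t ht)).congr_deriv (by ring)⟩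

/-- Reflection `t ↦ −t` for forced solutions. [folklore] -/
theorem comp_neg (h : IsForcedSol2 Q F y y' s) :
    IsForcedSol2 (fun t ↦ Q (-t)) (fun t ↦ F (-t)) (fun t ↦ y (-t)) (fun t ↦ -y' (-t)) (-s) := by
  refine ⟨fun t ht ↦ ?_, fun t ht ↦ ?_⟩
  · have h1 := (h.hasDerivAt (-t) (by simpa using ht)).scomp t (hasDerivAt_neg t)
    exact h1.congr_deriv (by simp)
  · have h1 := ((h.hasDerivAt_deriv (-t) (by simpa using ht)).scomp t (hasDerivAt_neg t)).neg
    exact h1.congr_deriv (by rw [neg_one_smul, neg_neg])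

/-- The phase curve of a forced solution is an integral curve of the affine field
`(v₁, v₂) ↦ (v₂, Q t v₁ + F t)`. [folklore] -/
theorem hasDerivAt_phase (hy : IsForcedSol2 Q F y y' s) {t : ℝ} (ht : t ∈ s) :
    HasDerivAt (fun τ ↦ (y τ, y' τ)) (sol2Field Q t (y t, y' t) + (0, F t)) t := by
  have h := (hy.hasDerivAt t ht).prodMk (hy.hasDerivAt_deriv t ht)
  refine h.congr_deriv ?_
  simp [sol2Field]

/-- **Continuous dependence for forced equations, forward in time.** For solutions `y` of
`y'' = Q₁ y + F₁` and `z` of `z'' = Q₂ z + F₂` on a set containing `[t₀, b]`, with `‖Q₁‖ ≤ K`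
(`K ≥ 1`), `‖Q₁ − Q₂‖ ≤ η`, `‖z‖ ≤ P`, `‖F₁ − F₂‖ ≤ θ` on `[t₀, b]`:
`dist (y t, y' t) (z t, z' t) ≤ gronwallBound δ K (η P + θ) (t − t₀)` on `[t₀, b]`.
[cite: Hartman2002, Ch. V Thm. 2.1] -/
theorem dist_le_right (hy : IsForcedSol2 Q₁ F₁ y y' s) (hz : IsForcedSol2 Q₂ F₂ z z' s)
    {t₀ b K η P θ : ℝ} (hsub : Icc t₀ b ⊆ s) (hK : ∀ t ∈ Icc t₀ b, ‖Q₁ t‖ ≤ K) (hK1 : 1 ≤ K)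
    (hη : ∀ t ∈ Icc t₀ b, ‖Q₁ t - Q₂ t‖ ≤ η) (hP : ∀ t ∈ Icc t₀ b, ‖z t‖ ≤ P)
    (hθ : ∀ t ∈ Icc t₀ b, ‖F₁ t - F₂ t‖ ≤ θ) (hη0 : 0 ≤ η) :
    ∀ t ∈ Icc t₀ b, dist (y t, y' t) (z t, z' t) ≤
      gronwallBound (dist (y t₀, y' t₀) (z t₀, z' t₀)) K (η * P + θ) (t - t₀) := by
  intro t ht
  lift K to ℝ≥0 using zero_le_one.trans hK1 with K' hK'
  have key := dist_le_of_approx_trajectories_ODE_of_mem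
    (v := fun τ v ↦ sol2Field Q₁ τ v + (0, F₁ τ)) (s := fun _ ↦ univ) (K := K')
    (f := fun τ ↦ (y τ, y' τ)) (g := fun τ ↦ (z τ, z' τ))
    (f' := fun τ ↦ sol2Field Q₁ τ (y τ, y' τ) + (0, F₁ τ))
    (g' := fun τ ↦ sol2Field Q₂ τ (z τ, z' τ) + (0, F₂ τ))
    (a := t₀) (b := b) (εf := 0) (εg := η * P + θ) (δ := dist (y t₀, y' t₀) (z t₀, z' t₀))
    (fun τ hτ ↦ by
      have hL := (lipschitzWith_sol2Field Q₁ τ).weaken (K' := K') (by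
        change max 1 ‖Q₁ τ‖ ≤ (K' : ℝ)
        exact max_le hK1 (hK τ (Ico_subset_Icc_self hτ)))
      refine (LipschitzWith.of_dist_le_mul fun v w ↦ ?_).lipschitzOnWith
      rw [dist_add_right]
      exact hL.dist_le_mul v w)
    (fun τ hτ ↦ (hy.hasDerivAt_phase (hsub hτ)).continuousAt.continuousWithinAt)
    (fun τ hτ ↦ (hy.hasDerivAt_phase (hsub (Ico_subset_Icc_self hτ))).hasDerivWithinAt)
    (fun τ _ ↦ by simp)
    (fun τ _ ↦ mem_univ _)
    (fun τ hτ ↦ (hz.hasDerivAt_phase (hsub hτ)).continuousAt.continuousWithinAt)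
    (fun τ hτ ↦ (hz.hasDerivAt_phase (hsub (Ico_subset_Icc_self hτ))).hasDerivWithinAt)
    (fun τ hτ ↦ by
      have h1 : dist (sol2Field Q₂ τ (z τ, z' τ) + (0, F₂ τ)) (sol2Field Q₁ τ (z τ, z' τ) + (0, F₁ τ)) =
          ‖(Q₁ τ - Q₂ τ) * z τ + (F₁ τ - F₂ τ)‖ := by
        change dist (z' τ + 0, Q₂ τ * z τ + F₂ τ) (z' τ + 0, Q₁ τ * z τ + F₁ τ) = _
        rw [Prod.dist_eq, dist_self, dist_eq_norm, norm_sub_rev, max_eq_right (by positivity)]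
        congr 1; ring
      rw [h1]
      refine (norm_add_le _ _).trans (add_le_add ?_ (hθ τ (Ico_subset_Icc_self hτ)))
      rw [norm_mul]
      exact mul_le_mul (hη τ (Ico_subset_Icc_self hτ)) (hP τ (Ico_subset_Icc_self hτ))
        (norm_nonneg _) hη0)
    (fun τ _ ↦ mem_univ _)
    le_rfl t ht
  rwa [zero_add] at key

/-- **Continuous dependence for forced equations on `[a, b] ∋ t₀`** (both time directions):
`dist (y t, y' t) (z t, z' t) ≤ (δ + (η P + θ)(b − a)) e^{K (b − a)}` on `[a, b]`, hypotheses as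
in `dist_le_right` on `[a, b]`. [cite: Hartman2002, Ch. V Thm. 2.1] -/
theorem dist_le (hy : IsForcedSol2 Q₁ F₁ y y' s) (hz : IsForcedSol2 Q₂ F₂ z z' s)
    {a b t₀ K η P θ : ℝ} (hsub : Icc a b ⊆ s) (ht₀ : t₀ ∈ Icc a b)
    (hK : ∀ t ∈ Icc a b, ‖Q₁ t‖ ≤ K) (hK1 : 1 ≤ K) (hη : ∀ t ∈ Icc a b, ‖Q₁ t - Q₂ t‖ ≤ η)
    (hP : ∀ t ∈ Icc a b, ‖z t‖ ≤ P) (hθ : ∀ t ∈ Icc a b, ‖F₁ t - F₂ t‖ ≤ θ) (hη0 : 0 ≤ η)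
    (hP0 : 0 ≤ P) (hθ0 : 0 ≤ θ) :
    ∀ t ∈ Icc a b, dist (y t, y' t) (z t, z' t) ≤
      (dist (y t₀, y' t₀) (z t₀, z' t₀) + (η * P + θ) * (b - a)) * Real.exp (K * (b - a)) := by
  intro t ht
  have hεx : 0 ≤ η * P + θ := by positivity
  have hba : 0 ≤ b - a := by linarith [ht₀.1, ht₀.2]
  have h0 : 0 ≤ dist (y t₀, y' t₀) (z t₀, z' t₀) + (η * P + θ) * (b - a) :=
    add_nonneg dist_nonneg (mul_nonneg hεx hba)
  rcases le_total t₀ t with h | h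
  · have hs : Icc t₀ b ⊆ Icc a b := Icc_subset_Icc_left ht₀.1
    have h1 := hy.dist_le_right hz (hs.trans hsub) (fun τ hτ ↦ hK τ (hs hτ)) hK1
      (fun τ hτ ↦ hη τ (hs hτ)) (fun τ hτ ↦ hP τ (hs hτ)) (fun τ hτ ↦ hθ τ (hs hτ)) hη0 t ⟨h, ht.2⟩
    refine h1.trans ((IsSol2.gronwallBound_le hK1 hεx).trans ?_)
    have hx : t - t₀ ≤ b - a := by linarith [ht.2, ht₀.1]
    gcongr
  · -- backward: reflect
    have hs : Icc a t₀ ⊆ Icc a b := Icc_subset_Icc_right ht₀.2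
    have hsub' : Icc (-t₀) (-a) ⊆ -s := fun τ hτ ↦ by
      have : -τ ∈ Icc a b := hs ⟨by linarith [hτ.2], by linarith [hτ.1]⟩
      simpa using hsub this
    have h1 := dist_le_right hy.comp_neg hz.comp_neg (t₀ := -t₀) (b := -a) (K := K) (η := η)
      (P := P) (θ := θ) hsub' (fun τ hτ ↦ hK (-τ) (hs ⟨by linarith [hτ.2], by linarith [hτ.1]⟩)) hK1
      (fun τ hτ ↦ hη (-τ) (hs ⟨by linarith [hτ.2], by linarith [hτ.1]⟩))
      (fun τ hτ ↦ hP (-τ) (hs ⟨by linarith [hτ.2], by linarith [hτ.1]⟩))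
      (fun τ hτ ↦ hθ (-τ) (hs ⟨by linarith [hτ.2], by linarith [hτ.1]⟩)) hη0 (-t)
      ⟨by linarith [ht.2], by linarith [ht.1]⟩
    simp only [neg_neg] at h1
    have hd : ∀ (p q p' q' : 𝕜), dist (p, -q) (p', -q') = dist (p, q) (p', q') := fun p q p' q' ↦ by
      rw [Prod.dist_eq, Prod.dist_eq, dist_neg_neg]
    rw [hd, hd, show -t - -t₀ = t₀ - t by ring] at h1
    refine h1.trans ((IsSol2.gronwallBound_le hK1 hεx).trans ?_)
    have hx : t₀ - t ≤ b - a := by linarith [ht.1, ht₀.2]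
    gcongr

/-- **A priori bound for zero data**: a forced solution with `y t₀ = y' t₀ = 0` satisfies
`‖(y t, y' t)‖ ≤ θ (b − a) e^{K (b − a)}` on `[a, b]` when `‖Q‖ ≤ K` (`K ≥ 1`) and `‖F‖ ≤ θ`
there. [folklore] -/
theorem norm_le_of_zero_data (hy : IsForcedSol2 Q F y y' s) {a b t₀ K θ : ℝ} (hsub : Icc a b ⊆ s)
    (ht₀ : t₀ ∈ Icc a b) (hK : ∀ t ∈ Icc a b, ‖Q t‖ ≤ K) (hK1 : 1 ≤ K)
    (hθ : ∀ t ∈ Icc a b, ‖F t‖ ≤ θ) (hθ0 : 0 ≤ θ) (h0 : y t₀ = 0) (h1 : y' t₀ = 0) :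
    ∀ t ∈ Icc a b, ‖(y t, y' t)‖ ≤ θ * (b - a) * Real.exp (K * (b - a)) := by
  intro t ht
  have h := hy.dist_le (IsForcedSol2.zero (Q := Q) (s := s)) hsub ht₀ hK hK1 (η := 0) (P := 0)
    (fun τ _ ↦ by simp) (fun τ _ ↦ by simp) (fun τ hτ ↦ by simpa using hθ τ hτ) le_rfl le_rfl hθ0 t ht
  simpa [h0, h1, dist_eq_norm] using h

end IsForcedSol2

/-! ## Families of equations: continuity and holomorphy in a parameter -/

section Parametric

variable {ι : Type*} [Fintype ι]

/-- **Uniform smallness of a separated perturbation.** If `‖g i p − g i p₀‖ ≤ ε` for all `i` and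
`‖h i t‖ ≤ H` on `[a, b]`, then `‖Σ g i p · h i t − Σ g i p₀ · h i t‖ ≤ (card ι) ε H` there.
[folklore] -/
theorem norm_sum_mul_sub_le {P : Type*} {g : ι → P → 𝕜} {h : ι → ℝ → 𝕜} {p p₀ : P} {ε H : ℝ}
    {t : ℝ} (hg : ∀ i, ‖g i p - g i p₀‖ ≤ ε) (hh : ∀ i, ‖h i t‖ ≤ H) (hε : 0 ≤ ε) :
    ‖∑ i, g i p * h i t - ∑ i, g i p₀ * h i t‖ ≤ Fintype.card ι * (ε * H) := by
  rw [← Finset.sum_sub_distrib]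
  refine (norm_sum_le _ _).trans ?_
  calc ∑ i, ‖g i p * h i t - g i p₀ * h i t‖ ≤ ∑ _i : ι, ε * H := Finset.sum_le_sum fun i _ ↦ by
        rw [← sub_mul, norm_mul]
        exact mul_le_mul (hg i) (hh i) (norm_nonneg _) hε
    _ = Fintype.card ι * (ε * H) := by simp

/-- A bound for a separated coefficient: `‖Σ g i p · h i t‖ ≤ (card ι) G H` when `‖g i p‖ ≤ G`,
`‖h i t‖ ≤ H`. [folklore] -/
theorem norm_sum_mul_le {P : Type*} {g : ι → P → 𝕜} {h : ι → ℝ → 𝕜} {p : P} {G H : ℝ}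
    {t : ℝ} (hg : ∀ i, ‖g i p‖ ≤ G) (hh : ∀ i, ‖h i t‖ ≤ H) (hG : 0 ≤ G) :
    ‖∑ i, g i p * h i t‖ ≤ Fintype.card ι * (G * H) := by
  refine (norm_sum_le _ _).trans ?_
  calc ∑ i, ‖g i p * h i t‖ ≤ ∑ _i : ι, G * H := Finset.sum_le_sum fun i _ ↦ by
        rw [norm_mul]
        exact mul_le_mul (hg i) (hh i) (norm_nonneg _) hG
    _ = Fintype.card ι * (G * H) := by simp

/-- Continuous functions on `[a, b]` are uniformly bounded (finitely many at once). [folklore] -/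
theorem exists_forall_norm_le_of_continuousOn {h : ι → ℝ → 𝕜} {a b : ℝ}
    (hh : ∀ i, ContinuousOn (h i) (Icc a b)) : ∃ H : ℝ, 0 ≤ H ∧ ∀ i, ∀ t ∈ Icc a b, ‖h i t‖ ≤ H := by
  have hi : ∀ i, ∃ Hi : ℝ, 0 ≤ Hi ∧ ∀ t ∈ Icc a b, ‖h i t‖ ≤ Hi := fun i ↦ by
    obtain ⟨C, hC⟩ := (isCompact_Icc.image_of_continuousOn (hh i)).isBounded.exists_norm_le
    exact ⟨max C 0, le_max_right _ _, fun t ht ↦ (hC _ (mem_image_of_mem _ ht)).trans (le_max_left _ _)⟩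
  choose Hi hHi0 hHi using hi
  refine ⟨∑ i, Hi i, Finset.sum_nonneg fun i _ ↦ hHi0 i, fun i t ht ↦ (hHi i t ht).trans ?_⟩
  exact Finset.single_le_sum (fun j _ ↦ hHi0 j) (Finset.mem_univ i)

/-- A solution is bounded on a compact interval inside its domain. [folklore] -/
theorem IsSol2.exists_norm_le_Icc {Q : ℝ → 𝕜} {y y' : ℝ → 𝕜} {r₀ a b : ℝ}
    (hy : IsSol2 Q y y' (Ioi r₀)) (hab : Icc a b ⊆ Ioi r₀) :
    ∃ P : ℝ, 0 ≤ P ∧ ∀ t ∈ Icc a b, ‖y t‖ ≤ P := by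
  obtain ⟨C, hC⟩ := (isCompact_Icc.image_of_continuousOn
    (hy.continuousOn.1.mono hab)).isBounded.exists_norm_le
  exact ⟨max C 0, le_max_right _ _, fun t ht ↦ (hC _ (mem_image_of_mem _ ht)).trans (le_max_left _ _)⟩

/-- Finitely many limits at once: if each `g i` is continuous at `p₀` then eventually all
`‖g i p − g i p₀‖ ≤ δ`. [folklore] -/
theorem eventually_forall_norm_sub_le {P : Type*} [TopologicalSpace P] {g : ι → P → 𝕜} {p₀ : P}
    (hg : ∀ i, ContinuousAt (g i) p₀) {δ : ℝ} (hδ : 0 < δ) :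
    ∀ᶠ p in 𝓝 p₀, ∀ i, ‖g i p - g i p₀‖ ≤ δ := by
  rw [Filter.eventually_all]
  intro i
  have h := Metric.tendsto_nhds.1 (hg i) δ hδ
  exact h.mono fun p hp ↦ by simpa [dist_eq_norm] using hp.le

/-- **Continuity in the parameter.** Let `Q p t = Σ_i g i p · h i t` with `h i` continuous on
`[a, b] ⊂ (r₀, ∞)` and `g i` continuous at `p₀`, and let `y p` solve `y'' = Q p · y` on `(r₀, ∞)`
with data at `t₀ ∈ [a, b]` independent of `p`. Then `(y p t, y' p t) → (y p₀ t, y' p₀ t)` as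
`p → p₀`, uniformly in `t ∈ [a, b]`. [cite: Hartman2002, Ch. V Thm. 2.1] -/
theorem tendstoUniformlyOn_param {P : Type*} [TopologicalSpace P] {g : ι → P → 𝕜}
    {h : ι → ℝ → 𝕜} {r₀ a b t₀ : ℝ} (hab : Icc a b ⊆ Ioi r₀) (ht₀ : t₀ ∈ Icc a b) {p₀ : P}
    (hg : ∀ i, ContinuousAt (g i) p₀) (hh : ∀ i, ContinuousOn (h i) (Icc a b))
    {y y' : P → ℝ → 𝕜} (hy : ∀ p, IsSol2 (fun t ↦ ∑ i, g i p * h i t) (y p) (y' p) (Ioi r₀))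
    (h0 : ∀ p, y p t₀ = y p₀ t₀) (h1 : ∀ p, y' p t₀ = y' p₀ t₀) :
    TendstoUniformlyOn (fun p t ↦ (y p t, y' p t)) (fun t ↦ (y p₀ t, y' p₀ t)) (𝓝 p₀) (Icc a b) := by
  rw [Metric.tendstoUniformlyOn_iff]
  intro ε hε
  obtain ⟨H, hH0, hH⟩ := exists_forall_norm_le_of_continuousOn hh
  obtain ⟨P₀, hP0, hP⟩ := (hy p₀).exists_norm_le_Icc hab
  set G₀ : ℝ := 1 + ∑ i, ‖g i p₀‖ with hG₀
  have hG₀0 : 0 ≤ G₀ := by positivity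
  set K : ℝ := 1 + Fintype.card ι * (G₀ * H) with hK
  have hK1 : 1 ≤ K := by
    have : 0 ≤ (Fintype.card ι : ℝ) * (G₀ * H) := by positivity
    simp only [hK]; linarith
  have hba : 0 ≤ b - a := by linarith [ht₀.1, ht₀.2]
  -- the smallness parameter
  set η : ℝ := ε / (2 * ((P₀ + 1) * (b - a + 1) * Real.exp (K * (b - a)))) with hη
  have hη0 : 0 < η := by positivity
  set δ : ℝ := min 1 (η / (Fintype.card ι * H + 1)) with hδ
  have hδ0 : 0 < δ := lt_min zero_lt_one (by positivity)
  filter_upwards [eventually_forall_norm_sub_le hg hδ0] with p hp t ht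
  -- bounds for `Q p` and `Q p − Q p₀` on `[a, b]`
  have hgp : ∀ i, ‖g i p‖ ≤ G₀ := fun i ↦ by
    have h1 : ‖g i p‖ ≤ ‖g i p₀‖ + 1 := by
      have := norm_le_norm_add_norm_sub' (g i p) (g i p₀)
      linarith [hp i, min_le_left 1 (η / (Fintype.card ι * H + 1))]
    have h2 : ‖g i p₀‖ ≤ ∑ j, ‖g j p₀‖ :=
      Finset.single_le_sum (f := fun j ↦ ‖g j p₀‖) (fun j _ ↦ norm_nonneg _) (Finset.mem_univ i)
    linarith
  have hKb : ∀ τ ∈ Icc a b, ‖∑ i, g i p * h i τ‖ ≤ K := fun τ hτ ↦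
    (norm_sum_mul_le hgp (fun i ↦ hH i τ hτ) hG₀0).trans (by simp [hK])
  have hηb : ∀ τ ∈ Icc a b, ‖∑ i, g i p * h i τ - ∑ i, g i p₀ * h i τ‖ ≤ η := fun τ hτ ↦ by
    refine (norm_sum_mul_sub_le hp (fun i ↦ hH i τ hτ) hδ0.le).trans ?_
    have hδ' : δ ≤ η / (Fintype.card ι * H + 1) := min_le_right _ _
    have hpos : 0 < (Fintype.card ι : ℝ) * H + 1 := by positivity
    calc (Fintype.card ι : ℝ) * (δ * H) ≤ (Fintype.card ι * H + 1) * δ := by nlinarith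
      _ ≤ (Fintype.card ι * H + 1) * (η / (Fintype.card ι * H + 1)) := by gcongr
      _ = η := mul_div_cancel₀ _ hpos.ne'
  have hd := (hy p).dist_le (hy p₀) hab ht₀ hKb hK1 hηb hP hη0.le hP0 t ht
  rw [h0 p, h1 p, dist_self, zero_add] at hd
  rw [dist_comm]
  refine hd.trans_lt ?_
  have hexp := Real.exp_pos (K * (b - a))
  calc η * P₀ * (b - a) * Real.exp (K * (b - a))
      ≤ η * ((P₀ + 1) * (b - a + 1) * Real.exp (K * (b - a))) := by
        rw [show η * P₀ * (b - a) * Real.exp (K * (b - a)) = η * (P₀ * (b - a) * Real.exp (K * (b - a))) by ring]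
        gcongr <;> linarith
    _ = ε / 2 := by rw [hη]; field_simp
    _ < ε := by linarith

/-- The Cauchy criterion along a filter with values in a complete space: if for every `ε > 0`
some `U ∈ l` has `dist (Φ p) (Φ q) ≤ ε` for `p, q ∈ U`, then `Φ` converges along `l`.
[folklore] -/
theorem exists_tendsto_of_cauchy {P X : Type*} [PseudoMetricSpace X] [CompleteSpace X]
    {l : Filter P} [l.NeBot] {Φ : P → X}
    (h : ∀ ε > 0, ∃ U ∈ l, ∀ p ∈ U, ∀ q ∈ U, dist (Φ p) (Φ q) ≤ ε) :
    ∃ L : X, Tendsto Φ l (𝓝 L) := by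
  have hc : Cauchy (Filter.map Φ l) := by
    rw [Metric.cauchy_iff]
    refine ⟨Filter.map_neBot, fun ε hε ↦ ?_⟩
    obtain ⟨U, hU, hUε⟩ := h (ε / 2) (half_pos hε)
    refine ⟨Φ '' U, Filter.mem_map.2 (Filter.mem_of_superset hU (subset_preimage_image _ _)), ?_⟩
    rintro _ ⟨p, hp, rfl⟩ _ ⟨q, hq, rfl⟩
    exact (hUε p hp q hq).trans_lt (half_lt_self hε)
  obtain ⟨L, hL⟩ := CompleteSpace.complete hc
  exact ⟨L, hL⟩

/-- **Holomorphy (differentiability) in the parameter at a fixed time.** Let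
`Q p t = Σ_i g i p · h i t` with `h i` continuous on `[a, b] ⊂ (r₀, ∞)` and each `g i : 𝕜 → 𝕜`
differentiable at `p₀`, and let `y p` solve `y'' = Q p · y` on `(r₀, ∞)` with data at
`t₀ ∈ [a, b]` independent of `p`. Then for every `t ∈ [a, b]`, `p ↦ y p t` and `p ↦ y' p t` are
differentiable at `p₀` (over `𝕜`; for `𝕜 = ℂ`: holomorphic dependence on the parameter). Proof:
the difference quotients `(y p − y p₀)/(p − p₀)` solve forced equations whose coefficients and
forcings converge uniformly as `p → p₀`; by Grönwall they form a Cauchy family, uniformly on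
`[a, b]`, and their limit is the derivative (Hartman, Ch. V Thm. 3.1, specialised to a linear
equation, where no differentiability in the state is needed). [cite: Hartman2002, Ch. V Thm. 3.1] -/
theorem differentiableAt_param {g : ι → 𝕜 → 𝕜} {g' : ι → 𝕜} {h : ι → ℝ → 𝕜}
    {r₀ a b t₀ : ℝ} (hab : Icc a b ⊆ Ioi r₀) (ht₀ : t₀ ∈ Icc a b) {p₀ : 𝕜}
    (hg : ∀ i, HasDerivAt (g i) (g' i) p₀) (hh : ∀ i, ContinuousOn (h i) (Icc a b))
    {y y' : 𝕜 → ℝ → 𝕜} (hy : ∀ p, IsSol2 (fun t ↦ ∑ i, g i p * h i t) (y p) (y' p) (Ioi r₀))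
    (h0 : ∀ p, y p t₀ = y p₀ t₀) (h1 : ∀ p, y' p t₀ = y' p₀ t₀) {t : ℝ} (ht : t ∈ Icc a b) :
    DifferentiableAt 𝕜 (fun p ↦ y p t) p₀ ∧ DifferentiableAt 𝕜 (fun p ↦ y' p t) p₀ := by
  obtain ⟨H, hH0, hH⟩ := exists_forall_norm_le_of_continuousOn hh
  obtain ⟨P₀, hP0, hP⟩ := (hy p₀).exists_norm_le_Icc hab
  have hgc : ∀ i, ContinuousAt (g i) p₀ := fun i ↦ (hg i).continuousAt
  -- slopes of the `g i`
  set S : ι → 𝕜 → 𝕜 := fun i p ↦ slope (g i) p₀ p with hS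
  have hSl : ∀ i, Tendsto (S i) (𝓝[≠] p₀) (𝓝 (g' i)) := fun i ↦
    hasDerivAt_iff_tendsto_slope.1 (hg i)
  -- constants
  set G₀ : ℝ := 1 + ∑ i, ‖g i p₀‖ with hG₀
  have hG₀0 : 0 ≤ G₀ := by positivity
  set G₁ : ℝ := 1 + ∑ i, ‖g' i‖ with hG₁
  have hG₁0 : 0 ≤ G₁ := by positivity
  set K : ℝ := 1 + Fintype.card ι * (G₀ * H) with hK
  have hK1 : 1 ≤ K := by
    have : 0 ≤ (Fintype.card ι : ℝ) * (G₀ * H) := by positivity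
    simp only [hK]; linarith
  have hba : 0 ≤ b - a := by linarith [ht₀.1, ht₀.2]
  set Θ : ℝ := Fintype.card ι * (G₁ * H) * P₀ with hΘ
  have hΘ0 : 0 ≤ Θ := by positivity
  set B : ℝ := Θ * (b - a) * Real.exp (K * (b - a)) with hB
  have hB0 : 0 ≤ B := by positivity
  -- the difference quotients and their forced equations
  set c : 𝕜 → 𝕜 := fun p ↦ (p - p₀)⁻¹ with hc
  set D : 𝕜 → ℝ → 𝕜 := fun p τ ↦ c p * (y p τ - y p₀ τ) with hD
  set D' : 𝕜 → ℝ → 𝕜 := fun p τ ↦ c p * (y' p τ - y' p₀ τ) with hD'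
  have hforce : ∀ p τ, c p * ((∑ i, g i p * h i τ - ∑ i, g i p₀ * h i τ) * y p₀ τ) =
      (∑ i, S i p * h i τ) * y p₀ τ := by
    intro p τ
    have hS' : ∀ i, S i p = c p * (g i p - g i p₀) := fun i ↦ by
      simp [hS, hc, slope, smul_eq_mul]
    simp_rw [hS']
    rw [← mul_assoc, ← Finset.sum_sub_distrib, Finset.mul_sum]
    congr 1
    refine Finset.sum_congr rfl fun i _ ↦ ?_
    ring
  have hDsol : ∀ p, IsForcedSol2 (fun τ ↦ ∑ i, g i p * h i τ) (fun τ ↦ (∑ i, S i p * h i τ) * y p₀ τ)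
      (D p) (D' p) (Ioi r₀) := by
    intro p
    have h := (hy p).isForcedSol2_smul_sub (hy p₀) (c p)
    exact ⟨h.hasDerivAt, fun τ hτ ↦ (h.hasDerivAt_deriv τ hτ).congr_deriv (by rw [hforce])⟩
  have hD0 : ∀ p, D p t₀ = 0 := fun p ↦ by simp [hD, h0 p]
  have hD1 : ∀ p, D' p t₀ = 0 := fun p ↦ by simp [hD', h1 p]
  -- the good punctured neighbourhood: `‖g i p − g i p₀‖ ≤ 1` and `‖S i p − g' i‖ ≤ 1`
  have hgood1 : ∀ᶠ p in 𝓝[≠] p₀, ∀ i, ‖g i p - g i p₀‖ ≤ 1 :=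
    nhdsWithin_le_nhds (eventually_forall_norm_sub_le hgc zero_lt_one)
  have hSev : ∀ {δ : ℝ}, 0 < δ → ∀ᶠ p in 𝓝[≠] p₀, ∀ i, ‖S i p - g' i‖ ≤ δ := fun {δ} hδ ↦ by
    rw [Filter.eventually_all]
    intro i
    exact (Metric.tendsto_nhds.1 (hSl i) δ hδ).mono fun p hp ↦ by simpa [dist_eq_norm] using hp.le
  -- consequences of goodness
  have hKb : ∀ p, (∀ i, ‖g i p - g i p₀‖ ≤ 1) → ∀ τ ∈ Icc a b, ‖∑ i, g i p * h i τ‖ ≤ K := by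
    intro p hp τ hτ
    have hgp : ∀ i, ‖g i p‖ ≤ G₀ := fun i ↦ by
      have h1 : ‖g i p‖ ≤ ‖g i p₀‖ + 1 := by
        have := norm_le_norm_add_norm_sub' (g i p) (g i p₀); linarith [hp i]
      have h2 : ‖g i p₀‖ ≤ ∑ j, ‖g j p₀‖ :=
        Finset.single_le_sum (f := fun j ↦ ‖g j p₀‖) (fun j _ ↦ norm_nonneg _) (Finset.mem_univ i)
      linarith
    exact (norm_sum_mul_le hgp (fun i ↦ hH i τ hτ) hG₀0).trans (by simp [hK])
  have hΘb : ∀ p, (∀ i, ‖S i p - g' i‖ ≤ 1) → ∀ τ ∈ Icc a b, ‖(∑ i, S i p * h i τ) * y p₀ τ‖ ≤ Θ := by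
    intro p hp τ hτ
    have hSp : ∀ i, ‖S i p‖ ≤ G₁ := fun i ↦ by
      have h1 : ‖S i p‖ ≤ ‖g' i‖ + 1 := by
        have := norm_le_norm_add_norm_sub' (S i p) (g' i); linarith [hp i]
      have h2 : ‖g' i‖ ≤ ∑ j, ‖g' j‖ :=
        Finset.single_le_sum (f := fun j ↦ ‖g' j‖) (fun j _ ↦ norm_nonneg _) (Finset.mem_univ i)
      linarith
    rw [norm_mul]
    exact mul_le_mul (norm_sum_mul_le hSp (fun i ↦ hH i τ hτ) hG₁0) (hP τ hτ) (norm_nonneg _)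
      (by positivity)
  have hBb : ∀ p, (∀ i, ‖g i p - g i p₀‖ ≤ 1) → (∀ i, ‖S i p - g' i‖ ≤ 1) →
      ∀ τ ∈ Icc a b, ‖D p τ‖ ≤ B := by
    intro p hp hp' τ hτ
    have h := (hDsol p).norm_le_of_zero_data hab ht₀ (hKb p hp) hK1 (hΘb p hp') hΘ0 (hD0 p) (hD1 p) τ hτ
    exact (norm_fst_le (D p τ, D' p τ)).trans h
  -- the Cauchy estimate
  set Φ : 𝕜 → 𝕜 × 𝕜 := fun p ↦ (D p t, D' p t) with hΦ
  have hCauchy : ∀ ε > 0, ∃ U ∈ 𝓝[≠] p₀, ∀ p ∈ U, ∀ q ∈ U, dist (Φ p) (Φ q) ≤ ε := by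
    intro ε hε
    -- smallness parameters
    set M : ℝ := (Fintype.card ι * H + 1) * (B + P₀ + 1) * (b - a + 1) * Real.exp (K * (b - a))
      with hM_def
    have hM0 : 0 < M := by positivity
    set δ : ℝ := ε / (4 * M) with hδ
    have hδ0 : 0 < δ := by positivity
    obtain ⟨U, hU, hUp⟩ := (hgood1.and ((hSev zero_lt_one).and ((hSev hδ0).and
      (nhdsWithin_le_nhds (eventually_forall_norm_sub_le hgc hδ0))))).exists_mem
    refine ⟨U, hU, fun p hp q hq ↦ ?_⟩
    obtain ⟨hp1, -, hp2, hp3⟩ := hUp p hp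
    obtain ⟨hq1, hq1', hq2, hq3⟩ := hUp q hq
    -- `‖Q p − Q q‖ ≤ card (2δ H)` and `‖G p − G q‖ ≤ card (2δ H) P₀`
    have hη : ∀ τ ∈ Icc a b, ‖∑ i, g i p * h i τ - ∑ i, g i q * h i τ‖ ≤
        Fintype.card ι * (2 * δ * H) := fun τ hτ ↦
      norm_sum_mul_sub_le (fun i ↦ by
        have := norm_sub_le_norm_sub_add_norm_sub (g i p) (g i p₀) (g i q)
        rw [norm_sub_rev (g i p₀)] at this
        linarith [hp3 i, hq3 i]) (fun i ↦ hH i τ hτ) (by positivity)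
    have hθ : ∀ τ ∈ Icc a b, ‖(∑ i, S i p * h i τ) * y p₀ τ - (∑ i, S i q * h i τ) * y p₀ τ‖ ≤
        Fintype.card ι * (2 * δ * H) * P₀ := fun τ hτ ↦ by
      rw [← sub_mul, norm_mul]
      refine mul_le_mul (norm_sum_mul_sub_le (fun i ↦ ?_) (fun i ↦ hH i τ hτ) (by positivity))
        (hP τ hτ) (norm_nonneg _) (by positivity)
      have := norm_sub_le_norm_sub_add_norm_sub (S i p) (g' i) (S i q)
      rw [norm_sub_rev (g' i)] at this
      linarith [hp2 i, hq2 i]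
    have hd := (hDsol p).dist_le (hDsol q) hab ht₀ (hKb p hp1) hK1 hη (hBb q hq1 hq1') hθ
      (by positivity) hB0 (by positivity) t ht
    rw [hD0, hD1, hD0, hD1, dist_self, zero_add] at hd
    refine hd.trans ?_
    have hM : (Fintype.card ι : ℝ) * H * (B + P₀) * (b - a) * Real.exp (K * (b - a)) ≤ M := by
      simp only [hM_def]
      have h1 : (Fintype.card ι : ℝ) * H ≤ Fintype.card ι * H + 1 := by linarith
      have h2 : B + P₀ ≤ B + P₀ + 1 := by linarith
      have h3 : b - a ≤ b - a + 1 := by linarith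
      exact mul_le_mul (mul_le_mul (mul_le_mul h1 h2 (by positivity) (by positivity)) h3 hba
        (by positivity)) le_rfl (Real.exp_pos _).le (by positivity)
    calc (Fintype.card ι * (2 * δ * H) * B + Fintype.card ι * (2 * δ * H) * P₀) * (b - a) *
          Real.exp (K * (b - a))
        = 2 * δ * ((Fintype.card ι : ℝ) * H * (B + P₀) * (b - a) * Real.exp (K * (b - a))) := by ring
      _ ≤ 2 * δ * M := by gcongr
      _ = ε / 2 := by rw [hδ]; field_simp; ring
      _ ≤ ε := by linarith
  obtain ⟨L, hL⟩ := exists_tendsto_of_cauchy hCauchy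
  -- identify the components as slopes
  have hL1 : Tendsto (fun p ↦ D p t) (𝓝[≠] p₀) (𝓝 L.1) := (continuous_fst.tendsto L).comp hL
  have hL2 : Tendsto (fun p ↦ D' p t) (𝓝[≠] p₀) (𝓝 L.2) := (continuous_snd.tendsto L).comp hL
  have hs1 : (fun p ↦ D p t) = slope (fun p ↦ y p t) p₀ := by
    funext p; simp [hD, hc, slope, smul_eq_mul]
  have hs2 : (fun p ↦ D' p t) = slope (fun p ↦ y' p t) p₀ := by
    funext p; simp [hD', hc, slope, smul_eq_mul]
  rw [hs1] at hL1
  rw [hs2] at hL2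
  exact ⟨(hasDerivAt_iff_tendsto_slope.2 hL1).differentiableAt,
    (hasDerivAt_iff_tendsto_slope.2 hL2).differentiableAt⟩

end Parametric

end Literature.Analysis.ODE
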